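import Summits.MatrixMultiplication.MatrixMultiplication.Theorems.AbelianSTPPCensusShapeCertVQSearchP
import Summits.MatrixMultiplication.MatrixMultiplication.Theorems.AbelianSTPPCensusShapeCertVQEvalP413a
import Summits.MatrixMultiplication.MatrixMultiplication.Theorems.AbelianSTPPCensusShapeCertVQEvalP413b
import Summits.MatrixMultiplication.MatrixMultiplication.Theorems.AbelianSTPPCensusShapeCertVQEvalP413c

/-!
# Abelian STPP census — the budgeted vQ certificate at order 413, assembled from its path segments

Cell mm-stpp, rung F-M1; successor kernel item VQ-CERT in support of the closed crux item stmt-MatrixMultiplication-19191; seat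
mm-stpp-vp-p2 (gen 1); support file (no definitions, no kernel search).  Folds the kernel-evaluated path segments of
`…ShapeCertVQEvalP413a…` into `ShapeCertVQ.checkQE 413 = true` with `pathSegQE_append` / `pathOK_of_seg` / `pathSeg_single_of_child` /
`checkQE_of_pathOK_nil` (`…ShapeCertVQSearchP`).
WHAT THIS IS NOT: a Boolean fact; no statement about STPP families or `ω` by itself.
-/

set_option linter.dupNamespace false -- `MatrixMultiplication.MatrixMultiplication` (summit = problem, D-0017)
set_option autoImplicit false

namespace Summit.MatrixMultiplication.MatrixMultiplication.Theorems.ShapeCertVQ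

/-- the node `[81]` of order `413` is accepted by the budgeted search -/
theorem pok_413_r_81 : PathOK 413 [81] :=
  pathOK_of_seg (pathSegQE_append (pathSegQE_append ps_413_r_81_0 ps_413_r_81_1) ps_413_r_81_29) (lt_of_lt_of_le (pathNode_pool_lt 413 [81]) (by norm_num)) (by norm_num)

/-- the node `[82]` of order `413` is accepted by the budgeted search -/
theorem pok_413_r_82 : PathOK 413 [82] :=
  pathOK_of_seg (pathSegQE_append ps_413_r_82_0 ps_413_r_82_28) (lt_of_lt_of_le (pathNode_pool_lt 413 [82]) (by norm_num)) (by norm_num)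

/-- one-candidate path segment at node `[]`, candidate `81`, from its child node -/
theorem ps_413_r_81 : pathSegQE 413 [] 81 1 = true :=
  pathSeg_single_of_child ps_413_r_4768 pok_413_r_81 (by norm_num)

/-- one-candidate path segment at node `[]`, candidate `82`, from its child node -/
theorem ps_413_r_82 : pathSegQE 413 [] 82 1 = true :=
  pathSeg_single_of_child ps_413_r_4768 pok_413_r_82 (by norm_num)

/-- the node `[]` of order `413` is accepted by the budgeted search -/
theorem pok_413_r : PathOK 413 [] :=
  pathOK_of_seg (pathSegQE_append (pathSegQE_append (pathSegQE_append (pathSegQE_append (pathSegQE_append (pathSegQE_append (pathSegQE_append (pathSegQE_append ps_413_r_0 ps_413_r_81) ps_413_r_82) ps_413_r_83) ps_413_r_90) ps_413_r_107) ps_413_r_109) ps_413_r_496) ps_413_r_4768) (lt_of_lt_of_le (pathNode_pool_lt 413 []) (by norm_num)) (by norm_num)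

/-- **budgeted vQ certificate check at order `413`**, assembled from its path segments -/
theorem checkQE_413 : checkQE 413 = true := checkQE_of_pathOK_nil pok_413_r

end Summit.MatrixMultiplication.MatrixMultiplication.Theorems.ShapeCertVQ
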